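import Summits.ABC.StewartYu.PadicW80Par3C
import HarnessLib

/-!
# The `q = 3` (`p = 2`) parameter record — the sharp closed-form sizes and the two BUDGETS

Support file (theorems only; no named facts), cell `abc-stewartyu` (p1; crux `W80Two` stmt-ABC-19486; design memo
HOME/p1/S2-q3-record-design.md).  Base-`3` twin of `PadicW80BudgetsL` / `PadicW80ParLPM` in the fine unit
`𝔔 = exp(𝔘/1024)` (`𝔘 = U/3ᵐ`) and the height unit `E(c) = exp(c𝔘/(3c_L'))`: positivity and logarithms of the
closed forms `Amax3 = 𝔔²¹E(3)`, `PrV3 = 2𝔔²²E(3)`, `DmaxK3 k = 𝔔¹⁶E(3^{k+1})`, `MmaxK3 k = 𝔔·PrV3·𝔔⁵E(3^{k+1})`,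
`DmaxT3 = 𝔔¹⁶E(3)`, `RThird3 = 𝔔⁵E(3)`, `MmaxT3 = 𝔔·PrV3·RThird3`, and
* the **inner-step budget** `log(DmaxK3 k · MmaxK3 k) ≤ 𝔘/16 + 3ᵏ𝔘/1024` (against the Schwarz gain
  `kpts·t_J·log 2 ≥ (31/32)(8/3)·log 2 · 3ᵏ𝔘 ≈ 1.79·3ᵏ𝔘` of `KT3_ge`);
* the **third-step budget** `3^{d+2} · log(6 · DmaxT3 · MmaxT3 · Hprod) ≤ 3ᵈ𝔘/2` for `1 ≤ Hprod ≤ exp(∑V + V_θ)`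
  (the multicubic Liouville threshold `(6·D·M·∏H)^{−(3^{d+2}−1)}` of lit's `MulticubLiouville.norm_ev3_ge_padic`;
  bracket `≤ log 12 + 44𝔘/1024 + 9𝔘/12288 + 𝔘/2⁸⁸ ≈ 0.0437𝔘`, times `9·3ᵈ` gives `0.39·3ᵈ𝔘`).
Everything is [folklore].
-/

noncomputable section

open Finset Real

namespace Summit.ABC.StewartYu

open PadicW80Par (cTp cSp cLp cLp' Ap mRp)

namespace PadicW80ParL

variable {d : ℕ} (P : PadicW80ParL d)

/-! ### Positivity of the closed forms -/

/-- `0 < Amax3`. [folklore] -/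
theorem Amax3_pos : 0 < P.Amax3 := by unfold Amax3; have := P.𝔔3_pos; have := P.Efac3_pos 3; positivity

/-- `1 ≤ Amax3`. [folklore] -/
theorem one_le_Amax3 : 1 ≤ P.Amax3 := by
  unfold Amax3; exact one_le_mul_of_one_le_of_one_le (P.one_le_𝔔3_pow 21) (P.one_le_Efac3 (by norm_num))

/-- `0 < PrV3`. [folklore] -/
theorem PrV3_pos : 0 < P.PrV3 := by unfold PrV3; have := P.𝔔3_pos; have := P.Efac3_pos 3; positivity

/-- `1 ≤ PrV3`. [folklore] -/
theorem one_le_PrV3 : 1 ≤ P.PrV3 := by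
  unfold PrV3
  have h1 := P.one_le_𝔔3_pow 22; have h2 := P.one_le_Efac3 (show (0 : ℝ) ≤ 3 by norm_num)
  nlinarith

/-- `𝔔 · Amax3 + 1 ≤ PrV3` (the ceiling `⌈#box₀·Amax3⌉` with `#box₀ ≤ 𝔔` is `≤ PrV3`). [folklore] -/
theorem 𝔔3_mul_Amax3_add_one_le : P.𝔔3 * P.Amax3 + 1 ≤ P.PrV3 := by
  unfold Amax3 PrV3
  have h1 : 1 ≤ P.𝔔3 ^ 22 * P.Efac3 3 :=
    one_le_mul_of_one_le_of_one_le (P.one_le_𝔔3_pow 22) (P.one_le_Efac3 (by norm_num))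
  have e : P.𝔔3 * (P.𝔔3 ^ 21 * P.Efac3 3) = P.𝔔3 ^ 22 * P.Efac3 3 := by ring
  rw [e]; linarith

/-- `0 < DmaxK3 k`. [folklore] -/
theorem DmaxK3_pos (k : ℕ) : 0 < P.DmaxK3 k := by
  unfold DmaxK3; have := P.𝔔3_pos; have := P.Efac3_pos ((3 ^ (k + 1) : ℕ) : ℝ); positivity

/-- `0 < MmaxK3 k`. [folklore] -/
theorem MmaxK3_pos (k : ℕ) : 0 < P.MmaxK3 k := by
  unfold MmaxK3; have := P.𝔔3_pos; have := P.PrV3_pos; have := P.Efac3_pos ((3 ^ (k + 1) : ℕ) : ℝ); positivity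

/-- `0 < DmaxT3`. [folklore] -/
theorem DmaxT3_pos : 0 < P.DmaxT3 := by unfold DmaxT3; have := P.𝔔3_pos; have := P.Efac3_pos 3; positivity

/-- `1 ≤ DmaxT3`. [folklore] -/
theorem one_le_DmaxT3 : 1 ≤ P.DmaxT3 := by
  unfold DmaxT3; exact one_le_mul_of_one_le_of_one_le (P.one_le_𝔔3_pow 16) (P.one_le_Efac3 (by norm_num))

/-- `0 < RThird3`. [folklore] -/
theorem RThird3_pos : 0 < P.RThird3 := by unfold RThird3; have := P.𝔔3_pos; have := P.Efac3_pos 3; positivity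

/-- `1 ≤ RThird3`. [folklore] -/
theorem one_le_RThird3 : 1 ≤ P.RThird3 := by
  unfold RThird3; exact one_le_mul_of_one_le_of_one_le (P.one_le_𝔔3_pow 5) (P.one_le_Efac3 (by norm_num))

/-- `0 < MmaxT3`. [folklore] -/
theorem MmaxT3_pos : 0 < P.MmaxT3 := by
  unfold MmaxT3; have := P.𝔔3_pos; have := P.PrV3_pos; have := P.RThird3_pos; positivity

/-- `1 ≤ MmaxT3`. [folklore] -/
theorem one_le_MmaxT3 : 1 ≤ P.MmaxT3 := by
  unfold MmaxT3
  exact one_le_mul_of_one_le_of_one_le (one_le_mul_of_one_le_of_one_le P.one_le_𝔔3 P.one_le_PrV3) P.one_le_RThird3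

/-! ### Logarithms of the closed forms -/

/-- `log PrV3 = log 2 + 22·𝔘/1024 + 3·𝔘/(3c_L')`. [folklore] -/
theorem log_PrV3 : Real.log P.PrV3 = Real.log 2 + 22 * (P.𝔘3 / 1024) + 3 * (P.𝔘3 / (3 * cLp')) := by
  unfold PrV3
  rw [Real.log_mul (by have := P.𝔔3_pos; positivity) (P.Efac3_pos 3).ne',
    Real.log_mul (by norm_num) (pow_pos P.𝔔3_pos _).ne', P.log_𝔔3_pow, P.log_Efac3]
  push_cast; ring

/-- `log(DmaxK3 k · MmaxK3 k) = log 2 + 44·𝔘/1024 + (2·3^{k+1} + 3)·𝔘/(3c_L')`. [folklore] -/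
theorem log_DmaxK3_mul_MmaxK3 (k : ℕ) : Real.log (P.DmaxK3 k * P.MmaxK3 k) =
    Real.log 2 + 44 * (P.𝔘3 / 1024) + (2 * (3 : ℝ) ^ (k + 1) + 3) * (P.𝔘3 / (3 * cLp')) := by
  have h𝔔 := P.𝔔3_pos; have hE := P.Efac3_pos ((3 ^ (k + 1) : ℕ) : ℝ); have hE3 := P.Efac3_pos 3
  have e : P.DmaxK3 k * P.MmaxK3 k =
      2 * (P.𝔔3 ^ 44 * (P.Efac3 3 * (P.Efac3 ((3 ^ (k + 1) : ℕ) : ℝ) * P.Efac3 ((3 ^ (k + 1) : ℕ) : ℝ)))) := by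
    unfold DmaxK3 MmaxK3 PrV3; ring
  rw [e, Real.log_mul (by norm_num) (by positivity), Real.log_mul (by positivity) (by positivity),
    Real.log_mul hE3.ne' (by positivity), Real.log_mul hE.ne' hE.ne', P.log_𝔔3_pow, P.log_Efac3, P.log_Efac3]
  push_cast; ring

/-- `log DmaxT3 = 16·𝔘/1024 + 3·𝔘/(3c_L')`. [folklore] -/
theorem log_DmaxT3 : Real.log P.DmaxT3 = 16 * (P.𝔘3 / 1024) + 3 * (P.𝔘3 / (3 * cLp')) := by
  unfold DmaxT3
  rw [Real.log_mul (pow_pos P.𝔔3_pos _).ne' (P.Efac3_pos 3).ne', P.log_𝔔3_pow, P.log_Efac3]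
  push_cast; ring

/-- `log MmaxT3 = log 2 + 28·𝔘/1024 + 6·𝔘/(3c_L')`. [folklore] -/
theorem log_MmaxT3 : Real.log P.MmaxT3 = Real.log 2 + 28 * (P.𝔘3 / 1024) + 6 * (P.𝔘3 / (3 * cLp')) := by
  have h𝔔 := P.𝔔3_pos; have hE := P.Efac3_pos 3
  have e : P.MmaxT3 = 2 * (P.𝔔3 ^ 28 * (P.Efac3 3 * P.Efac3 3)) := by
    unfold MmaxT3 PrV3 RThird3; ring
  rw [e, Real.log_mul (by norm_num) (by positivity), Real.log_mul (by positivity) (by positivity),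
    Real.log_mul hE.ne' hE.ne', P.log_𝔔3_pow, P.log_Efac3]
  push_cast; ring

/-! ### The two budgets -/

/-- **Budget of the inner steps**: `log(DmaxK3 k · MmaxK3 k) ≤ 𝔘/16 + 3ᵏ𝔘/1024`. [folklore] -/
theorem logDM3_le_budget (k : ℕ) : Real.log (P.DmaxK3 k * P.MmaxK3 k) ≤ P.𝔘3 / 16 + 3 ^ k * P.𝔘3 / 1024 := by
  rw [P.log_DmaxK3_mul_MmaxK3]
  have hU := P.𝔘3_ge'; have hl2 : Real.log 2 ≤ 1 := by linarith [Real.log_two_lt_d9]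
  have h3k : (1 : ℝ) ≤ 3 ^ k := one_le_pow₀ (by norm_num)
  have e3 : (3 : ℝ) ^ (k + 1) = 3 * 3 ^ k := by rw [pow_succ]; ring
  rw [e3]; unfold cLp'
  have hU0 : (0 : ℝ) ≤ P.𝔘3 := by linarith
  nlinarith [mul_nonneg (sub_nonneg.mpr h3k) hU0, show (2 : ℝ) ^ 96 ≥ 2 ^ 20 by norm_num]

/-- **Budget of the third step** (Liouville exponent `3^{d+2}` ≥ lit's `3^{d+2} − 1`): with
`1 ≤ Hprod ≤ exp(∑V + V_θ)` (and `∑V + V_θ ≤ 2⁻⁸⁸𝔘`), `3^{d+2}·log(6·DmaxT3·MmaxT3·Hprod) ≤ 3ᵈ·𝔘/2`.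
[cite: Yu1989, §3] -/
theorem bthird_le_budget3 {Hprod : ℝ} (hH1 : 1 ≤ Hprod) (hH : Hprod ≤ Real.exp ((∑ j, P.V j) + P.Vθ)) :
    (3 : ℝ) ^ (d + 2) * Real.log (6 * P.DmaxT3 * P.MmaxT3 * Hprod) ≤ 3 ^ d * P.𝔘3 / 2 := by
  have hD1 := P.one_le_DmaxT3; have hM1 := P.one_le_MmaxT3
  have hlogH : Real.log Hprod ≤ (∑ j, P.V j) + P.Vθ := by
    have := Real.log_le_log (by linarith) hH; rwa [Real.log_exp] at this
  have hlogH0 : 0 ≤ Real.log Hprod := Real.log_nonneg hH1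
  have hsum := P.sumV_le_𝔘3
  have e : Real.log (6 * P.DmaxT3 * P.MmaxT3 * Hprod) =
      Real.log 6 + Real.log P.DmaxT3 + Real.log P.MmaxT3 + Real.log Hprod := by
    rw [Real.log_mul (by positivity) (by positivity), Real.log_mul (by positivity) (by positivity),
      Real.log_mul (by norm_num) (by positivity)]
  rw [e, P.log_DmaxT3, P.log_MmaxT3]
  have hl2 : Real.log 2 ≤ 1 := by linarith [Real.log_two_lt_d9]
  have hl6 : Real.log 6 ≤ 2 := by
    have h36 : (6 : ℝ) ≤ Real.exp 2 := by
      have := Real.add_one_le_exp (2 : ℝ)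
      have h2 : Real.exp 2 = Real.exp 1 * Real.exp 1 := by rw [← Real.exp_add]; norm_num
      have he := Real.exp_one_gt_d9
      nlinarith
    calc Real.log 6 ≤ Real.log (Real.exp 2) := Real.log_le_log (by norm_num) h36
      _ = 2 := Real.log_exp 2
  have hU := P.𝔘3_ge'; have hU0 := P.𝔘3_pos
  unfold cLp'
  -- the bracket is `≤ 𝔘/18`, times `3^{d+2} = 9·3^d` gives `3^d 𝔘/2`
  have hbr : Real.log 6 + (16 * (P.𝔘3 / 1024) + 3 * (P.𝔘3 / (3 * 2 ^ 12))) +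
      (Real.log 2 + 28 * (P.𝔘3 / 1024) + 6 * (P.𝔘3 / (3 * 2 ^ 12))) + Real.log Hprod ≤ P.𝔘3 / 18 := by
    nlinarith [show (2 : ℝ) ^ 96 ≥ 2 ^ 93 by norm_num]
  have h3d : (0 : ℝ) ≤ 3 ^ (d + 2) := by positivity
  calc (3 : ℝ) ^ (d + 2) * (Real.log 6 + (16 * (P.𝔘3 / 1024) + 3 * (P.𝔘3 / (3 * 2 ^ 12))) +
        (Real.log 2 + 28 * (P.𝔘3 / 1024) + 6 * (P.𝔘3 / (3 * 2 ^ 12))) + Real.log Hprod)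
      ≤ 3 ^ (d + 2) * (P.𝔘3 / 18) := mul_le_mul_of_nonneg_left hbr h3d
    _ = 3 ^ d * P.𝔘3 / 2 := by rw [pow_add]; ring

/-- The same budget with lit's exponent `3^{d+2} − 1` (the bracket is non-negative). [folklore] -/
theorem bthird_le_budget3' {Hprod : ℝ} (hH1 : 1 ≤ Hprod) (hH : Hprod ≤ Real.exp ((∑ j, P.V j) + P.Vθ)) :
    ((3 : ℝ) ^ (d + 2) - 1) * Real.log (6 * P.DmaxT3 * P.MmaxT3 * Hprod) ≤ 3 ^ d * P.𝔘3 / 2 := by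
  have h := P.bthird_le_budget3 hH1 hH
  have hlog0 : 0 ≤ Real.log (6 * P.DmaxT3 * P.MmaxT3 * Hprod) := by
    apply Real.log_nonneg
    have hD1 := P.one_le_DmaxT3; have hM1 := P.one_le_MmaxT3
    have : (1 : ℝ) ≤ 6 * P.DmaxT3 := by nlinarith
    nlinarith [one_le_mul_of_one_le_of_one_le this hM1]
  nlinarith

/-! ### Relations to the coarse unit -/

/-- `DmaxT3 ≤ DmaxK3 k` (`E(3) ≤ E(3^{k+1})`). [folklore] -/
theorem DmaxT3_le_DmaxK3 (k : ℕ) : P.DmaxT3 ≤ P.DmaxK3 k := by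
  unfold DmaxT3 DmaxK3
  refine mul_le_mul_of_nonneg_left (P.Efac3_mono ?_) (pow_pos P.𝔔3_pos _).le
  have : (3 : ℝ) ^ 1 ≤ 3 ^ (k + 1) := pow_le_pow_right₀ (by norm_num) (by omega)
  push_cast; linarith [this]

end PadicW80ParL

end Summit.ABC.StewartYu

end
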